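import Summits.CriticalPhenomena.PercolationContinuityZ3.Theorems.PercNearOneGluingNoHeavyQuantFarTreeChainStep
import HarnessLib

/-!
# QUANT lane R8 — counts of independent events: convolution, strong log-concavity, "no rise after a fall"

builds on p205010 (kernel theorem, internal audit signed; external expert review pending)

Support file (`--supports stmt-CriticalPhenomena-4575`), QUANT lane lead (gen 9), rung R8 of `run/shared/lean/prim/quant/LADDER.md`;
memo `prim-quant-lead-g9/LEAD-NOTES-G9.md` N20 step (2) — first file of the kernel proof of FAR (`Quant.FarTreeRow`) at EVERY layer on
COMBS.  Gate coordinates: `prodBernoulli q` on `Set ι`, witnesses `z : κ` with pairwise disjoint finite gate sets `Q z`, `z` "occurs" iff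
`↑(Q z) ⊆ ω` (probability `∏_{i ∈ Q z} q i`); `L_Z(c) = P(#{z ∈ Z | Q z open} = c)` is a Poisson-binomial law.  Theorems only; no sorries.
* `Quant.indepEvents_law_insert` — convolution with one more witness: `L_{Z+z}(c) = p_z·P(#_Z + 1 = c) + (1 − p_z)·L_Z(c)`.
* `Quant.indepEvents_law_slc` — STRONG LOG-CONCAVITY `L_Z(u)·L_Z(v+2) ≤ L_Z(u+1)·L_Z(v+1)` (`u ≤ v`), by induction on `Z`
  (Newton's inequalities in the interval form that also forbids internal zeros).
* `Quant.indepEvents_law_mono_below_of_lt` / `_insert` / `Quant.indepEvents_law_le_of_mono_below` — if `L_Z(j) < L_Z(j+1)` then `L_Z` is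
  non-decreasing on `[0, j+1]`; this survives adding witnesses; and then `L(j+1)` cannot rise.
* `Quant.indepEvents_law_noRise` — **no rise after a fall**: for nested `Z ⊆ Z' ⊆ Z''` inside a pairwise-disjoint family,
  `L_Z(j) > L_{Z'}(j) ⟹ L_{Z''}(j) ≤ L_{Z'}(j)` — the unimodality of `k ↦ P(C_k = j)` along the spine of a comb used by
  `…QuantCombNoInteriorMin.lean`.
[folklore: log-concavity of Poisson-binomial laws (Newton); gate-set form and nested-family corollary: this work] [cite: Grimmett1999, §2.2]
-/

noncomputable section

namespace Summit.CriticalPhenomena.PercolationContinuityZ3.Theorems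

namespace Quant

open Finset MeasureTheory
open Literature.Probability.LatticeModels
open Literature.Probability.Percolation
open scoped Classical

variable {ι κ : Type*} [Finite ι]

/-! ### One more witness -/

omit [Finite ι] in
/-- Adding a witness `z ∉ Z` adds its indicator to the count. [folklore] -/
theorem indepEvents_card_filter_insert (Q : κ → Finset ι) (Z : Finset κ) {z : κ} (hz : z ∉ Z) (ω : Set ι) :
    ((insert z Z).filter fun w => ((Q w : Finset ι) : Set ι) ⊆ ω).card =
      (Z.filter fun w => ((Q w : Finset ι) : Set ι) ⊆ ω).card + (if ((Q z : Finset ι) : Set ι) ⊆ ω then 1 else 0) := by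
  rw [Finset.filter_insert]
  split_ifs with h
  · rw [Finset.card_insert_of_notMem (fun h' => hz (Finset.mem_filter.1 h').1)]
  · simp

/-- **Convolution with one more witness.**  If `z ∉ Z` and `Q z` is disjoint from every `Q w`, `w ∈ Z`, then for every `c`
`P(#_{Z+z} = c) = (∏_{Q z} q)·P(#_Z + 1 = c) + (1 − ∏_{Q z} q)·P(#_Z = c)` (the first event is empty for `c = 0`).
[folklore; independence of disjointly supported events] -/
theorem indepEvents_law_insert (q : ι → unitInterval) (Q : κ → Finset ι) (Z : Finset κ) {z : κ} (hz : z ∉ Z)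
    (hdisj : ∀ w ∈ Z, Disjoint (Q w) (Q z)) (c : ℕ) :
    (prodBernoulli q).real {ω : Set ι | ((insert z Z).filter fun w => ((Q w : Finset ι) : Set ι) ⊆ ω).card = c} =
      (∏ i ∈ Q z, (q i : ℝ)) *
          (prodBernoulli q).real {ω : Set ι | (Z.filter fun w => ((Q w : Finset ι) : Set ι) ⊆ ω).card + 1 = c} +
        (1 - ∏ i ∈ Q z, (q i : ℝ)) *
          (prodBernoulli q).real {ω : Set ι | (Z.filter fun w => ((Q w : Finset ι) : Set ι) ⊆ ω).card = c} := by
  set μ := prodBernoulli q with hμ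
  have hmeas : ∀ T : Set (Set ι), MeasurableSet T := fun T => (Set.toFinite T).measurableSet
  set O : Set (Set ι) := {ω | ((Q z : Finset ι) : Set ι) ⊆ ω} with hO
  set Em : Set (Set ι) := {ω | (Z.filter fun w => ((Q w : Finset ι) : Set ι) ⊆ ω).card + 1 = c} with hEm
  set Ec : Set (Set ι) := {ω | (Z.filter fun w => ((Q w : Finset ι) : Set ι) ⊆ ω).card = c} with hEc
  have hsplit : {ω : Set ι | ((insert z Z).filter fun w => ((Q w : Finset ι) : Set ι) ⊆ ω).card = c} = (Em ∩ O) ∪ (Ec \ O) := by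
    ext ω
    simp only [Set.mem_setOf_eq, Set.mem_union, Set.mem_inter_iff, Set.mem_sdiff, hEm, hEc, hO]
    rw [indepEvents_card_filter_insert Q Z hz ω]
    by_cases h : ((Q z : Finset ι) : Set ι) ⊆ ω
    · simp only [h, ↓reduceIte, and_true, not_true_eq_false, and_false, or_false]
    · simp only [h, ↓reduceIte, add_zero, and_false, not_false_eq_true, and_true, false_or]
  have hd : Disjoint (Em ∩ O) (Ec \ O) := Set.disjoint_left.2 fun ω h h' => h'.2 h.2
  -- supports and independence
  set F : Finset ι := Z.biUnion Q with hF
  have hFz : Disjoint F (Q z) := by rw [hF, Finset.disjoint_biUnion_left]; exact hdisj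
  have hQF : ∀ w ∈ Z, Q w ⊆ F := fun w hw => Finset.subset_biUnion_of_mem Q hw
  have dO : DeterminedBy O (↑(Q z) : Set ι) := determinedBy_subset_open (Q z)
  have dE : ∀ Φ : ℕ → Prop, DeterminedBy {ω : Set ι | Φ ((Z.filter fun w => ((Q w : Finset ι) : Set ι) ⊆ ω).card)} (↑F : Set ι) :=
    fun Φ => determinedBy_card_filter_open Z Q F hQF Φ
  have p1 : μ.real (Em ∩ O) = μ.real Em * μ.real O :=
    prodBernoulli_real_inter_of_determinedBy_disjoint q hFz (dE fun n => n + 1 = c) dO (hmeas _) (hmeas _)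
  have p2 : μ.real (Ec ∩ O) = μ.real Ec * μ.real O :=
    prodBernoulli_real_inter_of_determinedBy_disjoint q hFz (dE fun n => n = c) dO (hmeas _) (hmeas _)
  have p3 : μ.real (Ec ∩ O) + μ.real (Ec \ O) = μ.real Ec := measureReal_inter_add_sdiff (hmeas _)
  have hPO : μ.real O = ∏ i ∈ Q z, (q i : ℝ) := prodBernoulli_real_subset q (Q z)
  rw [hsplit, measureReal_union hd (hmeas _), p1, hPO]; rw [hPO] at p2
  linarith [p2, p3]

/-- Convolution at a successor: `L_{Z+z}(c+1) = p_z·L_Z(c) + (1 − p_z)·L_Z(c+1)`. [folklore] -/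
theorem indepEvents_law_insert_succ (q : ι → unitInterval) (Q : κ → Finset ι) (Z : Finset κ) {z : κ} (hz : z ∉ Z)
    (hdisj : ∀ w ∈ Z, Disjoint (Q w) (Q z)) (c : ℕ) :
    (prodBernoulli q).real {ω : Set ι | ((insert z Z).filter fun w => ((Q w : Finset ι) : Set ι) ⊆ ω).card = c + 1} =
      (∏ i ∈ Q z, (q i : ℝ)) *
          (prodBernoulli q).real {ω : Set ι | (Z.filter fun w => ((Q w : Finset ι) : Set ι) ⊆ ω).card = c} +
        (1 - ∏ i ∈ Q z, (q i : ℝ)) *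
          (prodBernoulli q).real {ω : Set ι | (Z.filter fun w => ((Q w : Finset ι) : Set ι) ⊆ ω).card = c + 1} := by
  rw [indepEvents_law_insert q Q Z hz hdisj (c + 1),
    show {ω : Set ι | (Z.filter fun w => ((Q w : Finset ι) : Set ι) ⊆ ω).card + 1 = c + 1} =
      {ω : Set ι | (Z.filter fun w => ((Q w : Finset ι) : Set ι) ⊆ ω).card = c} from by
        ext ω; simp only [Set.mem_setOf_eq]; omega]

/-- Convolution at zero: `L_{Z+z}(0) = (1 − p_z)·L_Z(0)`. [folklore] -/
theorem indepEvents_law_insert_zero (q : ι → unitInterval) (Q : κ → Finset ι) (Z : Finset κ) {z : κ} (hz : z ∉ Z)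
    (hdisj : ∀ w ∈ Z, Disjoint (Q w) (Q z)) :
    (prodBernoulli q).real {ω : Set ι | ((insert z Z).filter fun w => ((Q w : Finset ι) : Set ι) ⊆ ω).card = 0} =
      (1 - ∏ i ∈ Q z, (q i : ℝ)) *
        (prodBernoulli q).real {ω : Set ι | (Z.filter fun w => ((Q w : Finset ι) : Set ι) ⊆ ω).card = 0} := by
  rw [indepEvents_law_insert q Q Z hz hdisj 0,
    show {ω : Set ι | (Z.filter fun w => ((Q w : Finset ι) : Set ι) ⊆ ω).card + 1 = 0} = ∅ from by
      ext ω; simp only [Set.mem_setOf_eq, Set.mem_empty_iff_false, iff_false]; omega,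
    measureReal_empty, mul_zero, zero_add]

/-! ### Strong log-concavity -/

/-- **Strong log-concavity of the count law of independent events** (Newton's inequalities, interval form): for pairwise
disjoint gate sets, `L_Z(u)·L_Z(v+2) ≤ L_Z(u+1)·L_Z(v+1)` whenever `u ≤ v`. [folklore: Poisson-binomial laws are Pólya frequency sequences] -/
theorem indepEvents_law_slc (q : ι → unitInterval) (Q : κ → Finset ι) (Z : Finset κ)
    (hdisj : ∀ w ∈ Z, ∀ w' ∈ Z, w ≠ w' → Disjoint (Q w) (Q w')) {u v : ℕ} (huv : u ≤ v) :
    (prodBernoulli q).real {ω : Set ι | (Z.filter fun w => ((Q w : Finset ι) : Set ι) ⊆ ω).card = u} *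
        (prodBernoulli q).real {ω : Set ι | (Z.filter fun w => ((Q w : Finset ι) : Set ι) ⊆ ω).card = v + 2} ≤
      (prodBernoulli q).real {ω : Set ι | (Z.filter fun w => ((Q w : Finset ι) : Set ι) ⊆ ω).card = u + 1} *
        (prodBernoulli q).real {ω : Set ι | (Z.filter fun w => ((Q w : Finset ι) : Set ι) ⊆ ω).card = v + 1} := by
  induction Z using Finset.induction_on generalizing u v with
  | empty =>
    have h0 : {ω : Set ι | ((∅ : Finset κ).filter fun w => ((Q w : Finset ι) : Set ι) ⊆ ω).card = v + 2} = ∅ := by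
      ext ω; simp
    rw [h0, measureReal_empty, mul_zero]
    exact mul_nonneg measureReal_nonneg measureReal_nonneg
  | @insert z Z hz ih =>
    have hdZ : ∀ w ∈ Z, ∀ w' ∈ Z, w ≠ w' → Disjoint (Q w) (Q w') := fun w hw w' hw' hne =>
      hdisj w (mem_insert_of_mem hw) w' (mem_insert_of_mem hw') hne
    have hdz : ∀ w ∈ Z, Disjoint (Q w) (Q z) := fun w hw =>
      hdisj w (mem_insert_of_mem hw) z (mem_insert_self z Z) (fun h => hz (h ▸ hw))
    set L : ℕ → ℝ := fun c => (prodBernoulli q).real {ω : Set ι | (Z.filter fun w => ((Q w : Finset ι) : Set ι) ⊆ ω).card = c}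
      with hL
    set p : ℝ := ∏ i ∈ Q z, (q i : ℝ) with hp
    have hp0 : 0 ≤ p := Finset.prod_nonneg fun i _ => (q i).2.1
    have hp1 : p ≤ 1 := Finset.prod_le_one (fun i _ => (q i).2.1) fun i _ => (q i).2.2
    have hL0 : ∀ c, 0 ≤ L c := fun c => measureReal_nonneg
    have hsucc : ∀ c, (prodBernoulli q).real
        {ω : Set ι | ((insert z Z).filter fun w => ((Q w : Finset ι) : Set ι) ⊆ ω).card = c + 1} = p * L c + (1 - p) * L (c + 1) :=
      fun c => indepEvents_law_insert_succ q Q Z hz hdz c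
    have hzero : (prodBernoulli q).real
        {ω : Set ι | ((insert z Z).filter fun w => ((Q w : Finset ι) : Set ι) ⊆ ω).card = 0} = (1 - p) * L 0 :=
      indepEvents_law_insert_zero q Q Z hz hdz
    have IH : ∀ u v, u ≤ v → L u * L (v + 2) ≤ L (u + 1) * L (v + 1) := fun u v h => ih hdZ h
    rcases Nat.eq_zero_or_eq_succ_pred u with hu | hu
    · subst hu
      rw [hzero, hsucc (v + 1), hsucc 0, hsucc v]
      have hX := IH 0 v (Nat.zero_le v)
      simp only [zero_add] at hX ⊢
      nlinarith [mul_nonneg (mul_nonneg hp0 hp0) (mul_nonneg (hL0 0) (hL0 v)),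
        mul_nonneg (mul_nonneg hp0 (sub_nonneg.2 hp1)) (mul_nonneg (hL0 1) (hL0 v)),
        mul_nonneg (mul_nonneg (sub_nonneg.2 hp1) (sub_nonneg.2 hp1)) (sub_nonneg.2 hX)]
    · set u' := u.pred with hu'
      rw [hu] at huv ⊢
      rw [hsucc u', hsucc (v + 1), hsucc (u' + 1), hsucc v]
      have hX : L u' * L (v + 1) ≤ L (u' + 1) * L v := by
        obtain ⟨v', rfl⟩ : ∃ v', v = v' + 1 := ⟨v - 1, by omega⟩
        exact IH u' v' (by omega)
      have hY : L (u' + 1) * L (v + 2) ≤ L (u' + 2) * L (v + 1) := IH (u' + 1) v huv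
      have hW : L u' * L (v + 2) ≤ L (u' + 2) * L v := by
        rcases Nat.lt_or_ge (u' + 1) v with hlt | hge
        · obtain ⟨v', rfl⟩ : ∃ v', v = v' + 2 := ⟨v - 2, by omega⟩
          have h1 : L u' * L (v' + 2 + 2) ≤ L (u' + 1) * L (v' + 2 + 1) := IH u' (v' + 2) (by omega)
          have h2 : L (u' + 1) * L (v' + 1 + 2) ≤ L (u' + 1 + 1) * L (v' + 1 + 1) := IH (u' + 1) (v' + 1) (by omega)
          have e1 : v' + 2 + 1 = v' + 1 + 2 := by ring
          rw [e1] at h1; rw [show u' + 1 + 1 = u' + 2 by ring, show v' + 1 + 1 = v' + 2 by ring] at h2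
          exact h1.trans h2
        · have hv : v = u' + 1 := le_antisymm hge huv
          subst hv
          have h1 := IH u' (u' + 1) (by omega)
          rw [show u' + 1 + 1 = u' + 2 by ring] at h1 ⊢
          nlinarith [h1]
      nlinarith [mul_nonneg (mul_nonneg hp0 hp0) (sub_nonneg.2 hX),
        mul_nonneg (mul_nonneg (sub_nonneg.2 hp1) (sub_nonneg.2 hp1)) (sub_nonneg.2 hY),
        mul_nonneg (mul_nonneg hp0 (sub_nonneg.2 hp1)) (sub_nonneg.2 hW)]

/-! ### Monotonicity below the layer, and no rise after a fall -/

/-- If `L_Z(j) < L_Z(j+1)` then `c ↦ L_Z(c)` is non-decreasing on `[0, j+1]` (strong log-concavity). [folklore] -/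
theorem indepEvents_law_mono_below_of_lt (q : ι → unitInterval) (Q : κ → Finset ι) (Z : Finset κ)
    (hdisj : ∀ w ∈ Z, ∀ w' ∈ Z, w ≠ w' → Disjoint (Q w) (Q w')) {j : ℕ}
    (hlt : (prodBernoulli q).real {ω : Set ι | (Z.filter fun w => ((Q w : Finset ι) : Set ι) ⊆ ω).card = j} <
      (prodBernoulli q).real {ω : Set ι | (Z.filter fun w => ((Q w : Finset ι) : Set ι) ⊆ ω).card = j + 1}) :
    ∀ c ≤ j, (prodBernoulli q).real {ω : Set ι | (Z.filter fun w => ((Q w : Finset ι) : Set ι) ⊆ ω).card = c} ≤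
      (prodBernoulli q).real {ω : Set ι | (Z.filter fun w => ((Q w : Finset ι) : Set ι) ⊆ ω).card = c + 1} := by
  set L : ℕ → ℝ := fun c => (prodBernoulli q).real {ω : Set ι | (Z.filter fun w => ((Q w : Finset ι) : Set ι) ⊆ ω).card = c}
    with hL
  intro c hc
  show L c ≤ L (c + 1)
  have hlt' : L j < L (j + 1) := hlt
  have hL0 : ∀ c, 0 ≤ L c := fun c => measureReal_nonneg
  rcases Nat.lt_or_ge c j with h | h
  · obtain ⟨v, hv⟩ : ∃ v, j = v + 1 := ⟨j - 1, by omega⟩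
    have hslc : L c * L (v + 2) ≤ L (c + 1) * L (v + 1) := indepEvents_law_slc q Q Z hdisj (by omega)
    have e1 : v + 2 = j + 1 := by omega
    have e2 : v + 1 = j := by omega
    rw [e1, e2] at hslc
    have hpos : 0 < L (j + 1) := lt_of_le_of_lt (hL0 j) hlt'
    have : L c * L (j + 1) ≤ L (c + 1) * L (j + 1) :=
      hslc.trans (mul_le_mul_of_nonneg_left hlt'.le (hL0 _))
    exact le_of_mul_le_mul_right this hpos
  · have : c = j := le_antisymm hc h
    subst this; exact hlt'.le

/-- Monotonicity on `[0, j+1]` survives adding one (disjointly supported) witness. [folklore] -/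
theorem indepEvents_law_mono_below_insert (q : ι → unitInterval) (Q : κ → Finset ι) (Z : Finset κ) {z : κ} (hz : z ∉ Z)
    (hdisj : ∀ w ∈ Z, Disjoint (Q w) (Q z)) {j : ℕ}
    (hmono : ∀ c ≤ j, (prodBernoulli q).real {ω : Set ι | (Z.filter fun w => ((Q w : Finset ι) : Set ι) ⊆ ω).card = c} ≤
      (prodBernoulli q).real {ω : Set ι | (Z.filter fun w => ((Q w : Finset ι) : Set ι) ⊆ ω).card = c + 1}) :
    ∀ c ≤ j, (prodBernoulli q).real {ω : Set ι | ((insert z Z).filter fun w => ((Q w : Finset ι) : Set ι) ⊆ ω).card = c} ≤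
      (prodBernoulli q).real {ω : Set ι | ((insert z Z).filter fun w => ((Q w : Finset ι) : Set ι) ⊆ ω).card = c + 1} := by
  set L : ℕ → ℝ := fun c => (prodBernoulli q).real {ω : Set ι | (Z.filter fun w => ((Q w : Finset ι) : Set ι) ⊆ ω).card = c}
    with hL
  set p : ℝ := ∏ i ∈ Q z, (q i : ℝ) with hp
  have hp0 : 0 ≤ p := Finset.prod_nonneg fun i _ => (q i).2.1
  have hp1 : p ≤ 1 := Finset.prod_le_one (fun i _ => (q i).2.1) fun i _ => (q i).2.2
  have hL0 : ∀ c, 0 ≤ L c := fun c => measureReal_nonneg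
  have hmono' : ∀ c ≤ j, L c ≤ L (c + 1) := hmono
  intro c hc
  rw [indepEvents_law_insert_succ q Q Z hz hdisj c]
  rcases Nat.eq_zero_or_eq_succ_pred c with h0 | hs
  · subst h0
    rw [indepEvents_law_insert_zero q Q Z hz hdisj]
    have h01 := hmono' 0 hc
    show (1 - p) * L 0 ≤ p * L 0 + (1 - p) * L (0 + 1)
    nlinarith [hL0 0, mul_le_mul_of_nonneg_left h01 (sub_nonneg.2 hp1)]
  · set c' := c.pred
    rw [hs] at hc ⊢
    rw [indepEvents_law_insert_succ q Q Z hz hdisj c']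
    have h1 := hmono' c' (by omega)
    have h2 := hmono' (c' + 1) hc
    show p * L c' + (1 - p) * L (c' + 1) ≤ p * L (c' + 1) + (1 - p) * L (c' + 1 + 1)
    nlinarith [mul_le_mul_of_nonneg_left h1 hp0, mul_le_mul_of_nonneg_left h2 (sub_nonneg.2 hp1)]

/-- Under monotonicity on `[0, j]` (read: `∀ c < j, L_Z(c) ≤ L_Z(c+1)`), adding a witness cannot raise `L(j)`:
`L_{Z+z}(j) ≤ L_Z(j)`. [folklore] -/
theorem indepEvents_law_le_of_mono_below (q : ι → unitInterval) (Q : κ → Finset ι) (Z : Finset κ) {z : κ} (hz : z ∉ Z)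
    (hdisj : ∀ w ∈ Z, Disjoint (Q w) (Q z)) (j : ℕ)
    (hmono : ∀ c < j, (prodBernoulli q).real {ω : Set ι | (Z.filter fun w => ((Q w : Finset ι) : Set ι) ⊆ ω).card = c} ≤
      (prodBernoulli q).real {ω : Set ι | (Z.filter fun w => ((Q w : Finset ι) : Set ι) ⊆ ω).card = c + 1}) :
    (prodBernoulli q).real {ω : Set ι | ((insert z Z).filter fun w => ((Q w : Finset ι) : Set ι) ⊆ ω).card = j} ≤
      (prodBernoulli q).real {ω : Set ι | (Z.filter fun w => ((Q w : Finset ι) : Set ι) ⊆ ω).card = j} := by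
  set L : ℕ → ℝ := fun c => (prodBernoulli q).real {ω : Set ι | (Z.filter fun w => ((Q w : Finset ι) : Set ι) ⊆ ω).card = c}
    with hL
  set p : ℝ := ∏ i ∈ Q z, (q i : ℝ) with hp
  have hp0 : 0 ≤ p := Finset.prod_nonneg fun i _ => (q i).2.1
  have hp1 : p ≤ 1 := Finset.prod_le_one (fun i _ => (q i).2.1) fun i _ => (q i).2.2
  have hL0 : ∀ c, 0 ≤ L c := fun c => measureReal_nonneg
  rcases Nat.eq_zero_or_eq_succ_pred j with h0 | hs
  · subst h0
    rw [indepEvents_law_insert_zero q Q Z hz hdisj]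
    show (1 - p) * L 0 ≤ L 0
    nlinarith [hL0 0]
  · set j' := j.pred
    rw [hs]
    rw [indepEvents_law_insert_succ q Q Z hz hdisj j']
    have h1 : L j' ≤ L (j' + 1) := hmono j' (by omega)
    show p * L j' + (1 - p) * L (j' + 1) ≤ L (j' + 1)
    nlinarith [mul_le_mul_of_nonneg_left h1 hp0]

/-- A strict fall `L_{Z+z}(j) < L_Z(j)` forces monotonicity of `L_Z` on `[0, j]` (and `j ≥ 1`). [this work] -/
theorem indepEvents_law_mono_below_of_fall (q : ι → unitInterval) (Q : κ → Finset ι) (Z : Finset κ) {z : κ} (hz : z ∉ Z)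
    (hdisj : ∀ w ∈ insert z Z, ∀ w' ∈ insert z Z, w ≠ w' → Disjoint (Q w) (Q w')) {j : ℕ}
    (hfall : (prodBernoulli q).real {ω : Set ι | ((insert z Z).filter fun w => ((Q w : Finset ι) : Set ι) ⊆ ω).card = j} <
      (prodBernoulli q).real {ω : Set ι | (Z.filter fun w => ((Q w : Finset ι) : Set ι) ⊆ ω).card = j}) :
    ∀ c < j, (prodBernoulli q).real {ω : Set ι | (Z.filter fun w => ((Q w : Finset ι) : Set ι) ⊆ ω).card = c} ≤
      (prodBernoulli q).real {ω : Set ι | (Z.filter fun w => ((Q w : Finset ι) : Set ι) ⊆ ω).card = c + 1} := by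
  set L : ℕ → ℝ := fun c => (prodBernoulli q).real {ω : Set ι | (Z.filter fun w => ((Q w : Finset ι) : Set ι) ⊆ ω).card = c}
    with hL
  set p : ℝ := ∏ i ∈ Q z, (q i : ℝ) with hp
  have hp0 : 0 ≤ p := Finset.prod_nonneg fun i _ => (q i).2.1
  have hp1 : p ≤ 1 := Finset.prod_le_one (fun i _ => (q i).2.1) fun i _ => (q i).2.2
  have hL0 : ∀ c, 0 ≤ L c := fun c => measureReal_nonneg
  have hdZ : ∀ w ∈ Z, ∀ w' ∈ Z, w ≠ w' → Disjoint (Q w) (Q w') := fun w hw w' hw' hne =>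
    hdisj w (Finset.mem_insert_of_mem hw) w' (Finset.mem_insert_of_mem hw') hne
  have hdz : ∀ w ∈ Z, Disjoint (Q w) (Q z) := fun w hw =>
    hdisj w (Finset.mem_insert_of_mem hw) z (Finset.mem_insert_self z Z) (fun h => hz (h ▸ hw))
  rcases Nat.eq_zero_or_eq_succ_pred j with h0 | hs
  · intro c hc; omega
  · set j' := j.pred
    rw [hs] at hfall ⊢
    rw [indepEvents_law_insert_succ q Q Z hz hdz j'] at hfall
    -- `p·L j' + (1−p)·L(j'+1) < L(j'+1)` forces `L j' < L (j'+1)`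
    have hlt : L j' < L (j' + 1) := by
      by_contra hge
      push Not at hge
      have : L (j' + 1) ≤ p * L j' + (1 - p) * L (j' + 1) := by nlinarith [mul_le_mul_of_nonneg_left hge hp0]
      exact absurd hfall (not_lt.2 this)
    intro c hc
    exact indepEvents_law_mono_below_of_lt q Q Z hdZ hlt c (by omega)

/-- Monotonicity on `[0, j]` propagates along any extension of the family, and `L(j)` never rises again. [this work] -/
theorem indepEvents_law_le_of_mono_below_union (q : ι → unitInterval) (Q : κ → Finset ι) (Z D : Finset κ)
    (hdisj : ∀ w ∈ Z ∪ D, ∀ w' ∈ Z ∪ D, w ≠ w' → Disjoint (Q w) (Q w')) (j : ℕ)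
    (hmono : ∀ c < j, (prodBernoulli q).real {ω : Set ι | (Z.filter fun w => ((Q w : Finset ι) : Set ι) ⊆ ω).card = c} ≤
      (prodBernoulli q).real {ω : Set ι | (Z.filter fun w => ((Q w : Finset ι) : Set ι) ⊆ ω).card = c + 1}) :
    (∀ c < j, (prodBernoulli q).real {ω : Set ι | ((Z ∪ D).filter fun w => ((Q w : Finset ι) : Set ι) ⊆ ω).card = c} ≤
      (prodBernoulli q).real {ω : Set ι | ((Z ∪ D).filter fun w => ((Q w : Finset ι) : Set ι) ⊆ ω).card = c + 1}) ∧
    (prodBernoulli q).real {ω : Set ι | ((Z ∪ D).filter fun w => ((Q w : Finset ι) : Set ι) ⊆ ω).card = j} ≤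
      (prodBernoulli q).real {ω : Set ι | (Z.filter fun w => ((Q w : Finset ι) : Set ι) ⊆ ω).card = j} := by
  induction D using Finset.induction_on with
  | empty => simp only [Finset.union_empty]; exact ⟨hmono, le_rfl⟩
  | @insert z D hzD ih =>
    have hsub : Z ∪ D ⊆ Z ∪ insert z D := Finset.union_subset_union le_rfl (Finset.subset_insert z D)
    have hd' : ∀ w ∈ Z ∪ D, ∀ w' ∈ Z ∪ D, w ≠ w' → Disjoint (Q w) (Q w') := fun w hw w' hw' hne =>
      hdisj w (hsub hw) w' (hsub hw') hne
    obtain ⟨hm, hle⟩ := ih hd'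
    by_cases hzZ : z ∈ Z ∪ D
    · have : Z ∪ insert z D = Z ∪ D := by
        rw [Finset.union_insert, Finset.insert_eq_of_mem hzZ]
      rw [this]; exact ⟨hm, hle⟩
    · have heq : Z ∪ insert z D = insert z (Z ∪ D) := Finset.union_insert z Z D
      have hz' : z ∈ Z ∪ insert z D := Finset.mem_union_right Z (Finset.mem_insert_self z D)
      have hdz : ∀ w ∈ Z ∪ D, Disjoint (Q w) (Q z) := fun w hw =>
        hdisj w (hsub hw) z hz' (fun h => hzZ (h ▸ hw))
      rw [heq]
      refine ⟨?_, (indepEvents_law_le_of_mono_below q Q (Z ∪ D) hzZ hdz j hm).trans hle⟩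
      rcases Nat.eq_zero_or_eq_succ_pred j with h0 | hs
      · intro c hc; omega
      · intro c hc
        exact indepEvents_law_mono_below_insert q Q (Z ∪ D) hzZ hdz (j := j.pred)
          (fun c' hc' => hm c' (by omega)) c (by omega)

/-- Along an extension `Z ⊆ Z ∪ D`, either `L(j)` has not fallen, or monotonicity on `[0, j]` holds at the end. [this work] -/
theorem indepEvents_law_ge_or_mono_below_union (q : ι → unitInterval) (Q : κ → Finset ι) (Z D : Finset κ)
    (hdisj : ∀ w ∈ Z ∪ D, ∀ w' ∈ Z ∪ D, w ≠ w' → Disjoint (Q w) (Q w')) (j : ℕ) :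
    (prodBernoulli q).real {ω : Set ι | (Z.filter fun w => ((Q w : Finset ι) : Set ι) ⊆ ω).card = j} ≤
        (prodBernoulli q).real {ω : Set ι | ((Z ∪ D).filter fun w => ((Q w : Finset ι) : Set ι) ⊆ ω).card = j} ∨
      ∀ c < j, (prodBernoulli q).real {ω : Set ι | ((Z ∪ D).filter fun w => ((Q w : Finset ι) : Set ι) ⊆ ω).card = c} ≤
        (prodBernoulli q).real {ω : Set ι | ((Z ∪ D).filter fun w => ((Q w : Finset ι) : Set ι) ⊆ ω).card = c + 1} := by
  induction D using Finset.induction_on with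
  | empty => left; simp only [Finset.union_empty]; exact le_rfl
  | @insert z D hzD ih =>
    have hsub : Z ∪ D ⊆ Z ∪ insert z D := Finset.union_subset_union le_rfl (Finset.subset_insert z D)
    have hd' : ∀ w ∈ Z ∪ D, ∀ w' ∈ Z ∪ D, w ≠ w' → Disjoint (Q w) (Q w') := fun w hw w' hw' hne =>
      hdisj w (hsub hw) w' (hsub hw') hne
    by_cases hzZ : z ∈ Z ∪ D
    · have : Z ∪ insert z D = Z ∪ D := by
        rw [Finset.union_insert, Finset.insert_eq_of_mem hzZ]
      rw [this]; exact ih hd'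
    · have heq : Z ∪ insert z D = insert z (Z ∪ D) := Finset.union_insert z Z D
      have hz' : z ∈ Z ∪ insert z D := Finset.mem_union_right Z (Finset.mem_insert_self z D)
      have hdz : ∀ w ∈ Z ∪ D, Disjoint (Q w) (Q z) := fun w hw =>
        hdisj w (hsub hw) z hz' (fun h => hzZ (h ▸ hw))
      have hdi : ∀ w ∈ insert z (Z ∪ D), ∀ w' ∈ insert z (Z ∪ D), w ≠ w' → Disjoint (Q w) (Q w') := by
        rw [← heq]; exact hdisj
      rw [heq]
      rcases ih hd' with hge | hm
      · -- has the value fallen at this step?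
        by_cases hstep : (prodBernoulli q).real
            {ω : Set ι | ((insert z (Z ∪ D)).filter fun w => ((Q w : Finset ι) : Set ι) ⊆ ω).card = j} <
            (prodBernoulli q).real {ω : Set ι | ((Z ∪ D).filter fun w => ((Q w : Finset ι) : Set ι) ⊆ ω).card = j}
        · right
          have hmZD := indepEvents_law_mono_below_of_fall q Q (Z ∪ D) hzZ hdi hstep
          rcases Nat.eq_zero_or_eq_succ_pred j with h0 | hs
          · intro c hc; omega
          · intro c hc
            exact indepEvents_law_mono_below_insert q Q (Z ∪ D) hzZ hdz (j := j.pred)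
              (fun c' hc' => hmZD c' (by omega)) c (by omega)
        · left; push Not at hstep; exact hge.trans hstep
      · right
        rcases Nat.eq_zero_or_eq_succ_pred j with h0 | hs
        · intro c hc; omega
        · intro c hc
          exact indepEvents_law_mono_below_insert q Q (Z ∪ D) hzZ hdz (j := j.pred)
            (fun c' hc' => hm c' (by omega)) c (by omega)

/-- **No rise after a fall.**  For nested families `Z ⊆ Z' ⊆ Z''` inside a pairwise-disjoint family of gate sets: if
`L_Z(j) > L_{Z'}(j)` then `L_{Z''}(j) ≤ L_{Z'}(j)` — once `P(count = j)` has strictly decreased along a growing family of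
independent events, it never increases again (unimodality of `k ↦ P(C_k = j)`). [this work] -/
theorem indepEvents_law_noRise (q : ι → unitInterval) (Q : κ → Finset ι) (Z Z' Z'' : Finset κ) (h1 : Z ⊆ Z') (h2 : Z' ⊆ Z'')
    (hdisj : ∀ w ∈ Z'', ∀ w' ∈ Z'', w ≠ w' → Disjoint (Q w) (Q w')) (j : ℕ)
    (hfall : (prodBernoulli q).real {ω : Set ι | (Z'.filter fun w => ((Q w : Finset ι) : Set ι) ⊆ ω).card = j} <
      (prodBernoulli q).real {ω : Set ι | (Z.filter fun w => ((Q w : Finset ι) : Set ι) ⊆ ω).card = j}) :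
    (prodBernoulli q).real {ω : Set ι | (Z''.filter fun w => ((Q w : Finset ι) : Set ι) ⊆ ω).card = j} ≤
      (prodBernoulli q).real {ω : Set ι | (Z'.filter fun w => ((Q w : Finset ι) : Set ι) ⊆ ω).card = j} := by
  have hZ' : Z ∪ (Z' \ Z) = Z' := Finset.union_sdiff_of_subset h1
  have hZ'' : Z' ∪ (Z'' \ Z') = Z'' := Finset.union_sdiff_of_subset h2
  have hd1 : ∀ w ∈ Z ∪ (Z' \ Z), ∀ w' ∈ Z ∪ (Z' \ Z), w ≠ w' → Disjoint (Q w) (Q w') := by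
    rw [hZ']; exact fun w hw w' hw' hne => hdisj w (h2 hw) w' (h2 hw') hne
  have hd2 : ∀ w ∈ Z' ∪ (Z'' \ Z'), ∀ w' ∈ Z' ∪ (Z'' \ Z'), w ≠ w' → Disjoint (Q w) (Q w') := by
    rw [hZ'']; exact hdisj
  have hmono : ∀ c < j, (prodBernoulli q).real {ω : Set ι | (Z'.filter fun w => ((Q w : Finset ι) : Set ι) ⊆ ω).card = c} ≤
      (prodBernoulli q).real {ω : Set ι | (Z'.filter fun w => ((Q w : Finset ι) : Set ι) ⊆ ω).card = c + 1} := by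
    have h := indepEvents_law_ge_or_mono_below_union q Q Z (Z' \ Z) hd1 j
    rw [hZ'] at h
    rcases h with hge | hm
    · exact absurd hfall (not_lt.2 hge)
    · exact hm
  have h := (indepEvents_law_le_of_mono_below_union q Q Z' (Z'' \ Z') hd2 j hmono).2
  rwa [hZ''] at h

end Quant

end Summit.CriticalPhenomena.PercolationContinuityZ3.Theorems

end
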